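import Summits.CriticalPhenomena.CardyFormulaZ2.Theorems.CardyComplexConeParafermionToSLESixFamiliesFlipRLDict
import HarnessLib

/-!
# Return law, file 4: the algebra of the twelve phases `e^{−iπk/12}`
(line `flip-involution-return-law` of crux `CardyComplexCone.ParafermionToSLESixFamilies`, stmt-CriticalPhenomena-11389;
fourth helper file of the stub `stub_returnLaw`)

The return law's three identities, once the visit quantities of a once/twice pair are known
(`onceTwice_values`), are identities between the phases `phase (kπ/4) = e^{−iπk/12}`: with
`a = phase (π/4) = e^{−iπ/12}` and `b = phase (−π/4) = e^{iπ/12}` one has `ab = 1`, `phase (±π/2) = a², b²`,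
`phase (±π) = a⁴, b⁴`, `2cos(π/12) = a + b`, `√3 = a² + b²` (`2cos(π/6) = √3`), `e^{iπ/4} = b³`,
`e^{−iπ/4} = a³`, `g(1) = b⁴ − b²`, `g(−1) = a⁴ − a²` (`g = gTilt`). The two lemmas `pair_algebra_pos`
(registered sub-goal) / `pair_algebra_neg` then give the three pairwise sums for `σ = +1` / `σ = −1`
(`σ` the turn of the once-path at the toggled edge) by `linear_combination` over `ab = 1`.
-/


noncomputable section

namespace Summit.CriticalPhenomena.CardyFormulaZ2.Cruxes.ParafermionToSLESixFamilies.FlipInvolutionReturnLaw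

open MeasureTheory Filter Set Metric
open scoped BigOperators
open Literature.Probability Literature.Probability.LatticeModels Literature.Probability.Percolation

/-! ## The twelve phases -/

/-- `phase W = exp (−(W/3)·i)`. -/
theorem phase_eq_exp (W : ℝ) : phase W = Complex.exp (((-(W / 3) : ℝ) : ℂ) * Complex.I) := by
  rw [phase]; congr 1; push_cast; ring

/-- `a·b = 1` for `a = phase (π/4) = e^{−iπ/12}`, `b = phase (−π/4) = e^{iπ/12}`. -/
theorem phase_quarter_mul_neg_quarter : phase (Real.pi / 4) * phase (-(Real.pi / 4)) = 1 := by
  rw [phase_mul, add_neg_cancel, phase]; simp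

/-- `phase (π/2) = a²`. -/
theorem phase_half_pi : phase (Real.pi / 2) = phase (Real.pi / 4) * phase (Real.pi / 4) := by
  rw [phase_mul]; exact congrArg phase (by ring)

/-- `phase (−π/2) = b²`. -/
theorem phase_neg_half_pi : phase (-(Real.pi / 2)) = phase (-(Real.pi / 4)) * phase (-(Real.pi / 4)) := by
  rw [phase_mul]; exact congrArg phase (by ring)

/-- `phase π = a⁴`. -/
theorem phase_pi :
    phase Real.pi = phase (Real.pi / 4) * phase (Real.pi / 4) * phase (Real.pi / 4) * phase (Real.pi / 4) := by
  rw [phase_mul, phase_mul, phase_mul]; exact congrArg phase (by ring)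

/-- `phase (−π) = b⁴`. -/
theorem phase_neg_pi :
    phase (-Real.pi) = phase (-(Real.pi / 4)) * phase (-(Real.pi / 4)) * phase (-(Real.pi / 4)) * phase (-(Real.pi / 4)) := by
  rw [phase_mul, phase_mul, phase_mul]; exact congrArg phase (by ring)

/-- `2cos(π/12) = a + b`. -/
theorem cos_pi_div_twelve_eq : (Real.cos (Real.pi / 12) : ℂ) = (phase (Real.pi / 4) + phase (-(Real.pi / 4))) / 2 := by
  rw [Complex.ofReal_cos, Complex.cos, phase_eq_exp, phase_eq_exp]
  have h1 : (((-(Real.pi / 4 / 3)) : ℝ) : ℂ) * Complex.I = -((Real.pi / 12 : ℝ) : ℂ) * Complex.I := by push_cast; ring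
  have h2 : (((-(-(Real.pi / 4) / 3)) : ℝ) : ℂ) * Complex.I = ((Real.pi / 12 : ℝ) : ℂ) * Complex.I := by push_cast; ring
  rw [h1, h2]
  push_cast
  ring

/-- `√3 = a² + b²` (`2cos(π/6) = √3`). -/
theorem sqrt_three_eq : (Real.sqrt 3 : ℂ) =
    phase (Real.pi / 4) * phase (Real.pi / 4) + phase (-(Real.pi / 4)) * phase (-(Real.pi / 4)) := by
  have hc : Real.sqrt 3 = 2 * Real.cos (Real.pi / 6) := by rw [Real.cos_pi_div_six]; ring
  rw [hc, phase_mul, phase_mul]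
  push_cast
  rw [Complex.cos, phase_eq_exp, phase_eq_exp]
  have h1 : (((-((Real.pi / 4 + Real.pi / 4) / 3)) : ℝ) : ℂ) * Complex.I = -((Real.pi / 6 : ℝ) : ℂ) * Complex.I := by
    push_cast; ring
  have h2 : (((-((-(Real.pi / 4) + -(Real.pi / 4)) / 3)) : ℝ) : ℂ) * Complex.I = ((Real.pi / 6 : ℝ) : ℂ) * Complex.I := by
    push_cast; ring
  rw [h1, h2]
  push_cast
  ring

/-- `e^{iπ/4} = b³`. -/
theorem exp_I_pi_div_four : Complex.exp (Complex.I * (Real.pi : ℂ) / 4) =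
    phase (-(Real.pi / 4)) * phase (-(Real.pi / 4)) * phase (-(Real.pi / 4)) := by
  rw [phase_mul, phase_mul, phase_eq_exp]; congr 1; push_cast; ring

/-- `e^{−iπ/4} = a³`. -/
theorem exp_neg_I_pi_div_four : Complex.exp (-(Complex.I * (Real.pi : ℂ) / 4)) =
    phase (Real.pi / 4) * phase (Real.pi / 4) * phase (Real.pi / 4) := by
  rw [phase_mul, phase_mul, phase_eq_exp]; congr 1; push_cast; ring

/-- `g(1) = b⁴ − b²`. -/
theorem gTilt_one : gTilt 1 =
    phase (-(Real.pi / 4)) * phase (-(Real.pi / 4)) * phase (-(Real.pi / 4)) * phase (-(Real.pi / 4)) -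
      phase (-(Real.pi / 4)) * phase (-(Real.pi / 4)) := by
  rw [gTilt, phase_mul, phase_mul, phase_mul, phase_eq_exp, phase_eq_exp]
  congr 1
  · congr 1; push_cast; ring
  · congr 1; push_cast; ring

/-- `g(−1) = a⁴ − a²`. -/
theorem gTilt_neg_one : gTilt (-1) =
    phase (Real.pi / 4) * phase (Real.pi / 4) * phase (Real.pi / 4) * phase (Real.pi / 4) -
      phase (Real.pi / 4) * phase (Real.pi / 4) := by
  rw [gTilt, phase_mul, phase_mul, phase_mul, phase_eq_exp, phase_eq_exp]
  congr 1
  · congr 1; push_cast; ring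
  · congr 1; push_cast; ring

/-- **The twelve phases** (registered sub-goal `twelve_phases` of stmt-CriticalPhenomena-11389, line
`flip-involution-return-law`): `ab = 1`, `2cos(π/12) = a + b`, `√3 = a² + b²` for `a = phase (π/4) = e^{−iπ/12}`,
`b = phase (−π/4) = e^{iπ/12}` — the trigonometric content of the return law's coefficients `cos(π/12)` and
`1 − √3/2`. -/
theorem twelve_phases : phase (Real.pi / 4) * phase (-(Real.pi / 4)) = 1 ∧ (Real.cos (Real.pi / 12) : ℂ) = (phase (Real.pi / 4) + phase (-(Real.pi / 4))) / 2 ∧ (Real.sqrt 3 : ℂ) = phase (Real.pi / 4) * phase (Real.pi / 4) + phase (-(Real.pi / 4)) * phase (-(Real.pi / 4)) :=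
  ⟨phase_quarter_mul_neg_quarter, cos_pi_div_twelve_eq, sqrt_three_eq⟩

/-! ## The algebra of a once/twice pair, by the sign of the turn -/

/-- The three sums for a once/twice pair with `σ = 1` (the once-path crosses `z`; the twice-path follows
it first, `τ₁ = −1`). -/
theorem pair_algebra_pos (Φ PS₁ PS₂ FP₁ FP₂ TP₁ TP₂ TM₁ TM₂ IO₁ IO₂ : ℂ)
    (h1 : PS₁ = Φ * phase (Real.pi / 4 * ((1 : ℤ) : ℝ)))
    (h2 : PS₂ = Φ * phase (-(Real.pi / 4 * ((1 : ℤ) : ℝ))) + Φ * phase (Real.pi * ((1 : ℤ) : ℝ)) * phase (-(Real.pi / 4 * ((1 : ℤ) : ℝ))))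
    (h3 : FP₁ = Φ) (h4 : FP₂ = Φ) (h5 : TP₁ = 0) (h6 : TM₁ = 0) (h7 : TP₂ = 0) (h8 : TM₂ = Φ)
    (h9 : IO₁ = Φ - Φ * phase (Real.pi / 2 * ((1 : ℤ) : ℝ)))
    (h10 : IO₂ = (Φ - Φ * phase (-(Real.pi / 2 * ((1 : ℤ) : ℝ)))) + (Φ * phase (Real.pi * ((1 : ℤ) : ℝ)) - Φ * phase (Real.pi / 2 * ((1 : ℤ) : ℝ)))) :
    PS₁ + PS₂ = (Real.cos (Real.pi / 12) : ℂ) * (FP₁ + FP₂) + Complex.exp (Complex.I * (Real.pi : ℂ) / 4) * (TP₁ + TP₂) +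
        Complex.exp (-(Complex.I * (Real.pi : ℂ) / 4)) * (TM₁ + TM₂) ∧
      IO₁ + IO₂ = (1 - (Real.sqrt 3 : ℂ) / 2) * (FP₁ + FP₂) + gTilt 1 * (TP₁ + TP₂) + gTilt (-1) * (TM₁ + TM₂) ∧
      (TP₁ + TM₁) + (TP₂ + TM₂) = (FP₁ + FP₂) / 2 := by
  have hab := phase_quarter_mul_neg_quarter
  simp only [Int.cast_one, mul_one] at h1 h2 h9 h10
  rw [phase_pi] at h2 h10
  rw [phase_half_pi, phase_neg_half_pi] at h10
  rw [phase_half_pi] at h9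
  rw [h1, h2, h3, h4, h5, h6, h7, h8, h9, h10, cos_pi_div_twelve_eq, sqrt_three_eq, exp_I_pi_div_four, exp_neg_I_pi_div_four,
    gTilt_one, gTilt_neg_one]
  refine ⟨?_, ?_, ?_⟩
  · linear_combination (Φ * (phase (Real.pi / 4) * phase (Real.pi / 4) * phase (Real.pi / 4))) * hab
  · ring
  · ring

/-- The three sums for a once/twice pair with `σ = −1` (the once-path follows `z`; the twice-path crosses
it first, `τ₁ = +1`). -/
theorem pair_algebra_neg (Φ PS₁ PS₂ FP₁ FP₂ TP₁ TP₂ TM₁ TM₂ IO₁ IO₂ : ℂ)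
    (h1 : PS₁ = Φ * phase (Real.pi / 4 * ((-1 : ℤ) : ℝ)))
    (h2 : PS₂ = Φ * phase (-(Real.pi / 4 * ((-1 : ℤ) : ℝ))) + Φ * phase (Real.pi * ((-1 : ℤ) : ℝ)) * phase (-(Real.pi / 4 * ((-1 : ℤ) : ℝ))))
    (h3 : FP₁ = Φ) (h4 : FP₂ = Φ) (h5 : TP₁ = 0) (h6 : TM₁ = 0) (h7 : TP₂ = Φ) (h8 : TM₂ = 0)
    (h9 : IO₁ = Φ - Φ * phase (Real.pi / 2 * ((-1 : ℤ) : ℝ)))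
    (h10 : IO₂ = (Φ - Φ * phase (-(Real.pi / 2 * ((-1 : ℤ) : ℝ)))) + (Φ * phase (Real.pi * ((-1 : ℤ) : ℝ)) - Φ * phase (Real.pi / 2 * ((-1 : ℤ) : ℝ)))) :
    PS₁ + PS₂ = (Real.cos (Real.pi / 12) : ℂ) * (FP₁ + FP₂) + Complex.exp (Complex.I * (Real.pi : ℂ) / 4) * (TP₁ + TP₂) +
        Complex.exp (-(Complex.I * (Real.pi : ℂ) / 4)) * (TM₁ + TM₂) ∧
      IO₁ + IO₂ = (1 - (Real.sqrt 3 : ℂ) / 2) * (FP₁ + FP₂) + gTilt 1 * (TP₁ + TP₂) + gTilt (-1) * (TM₁ + TM₂) ∧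
      (TP₁ + TM₁) + (TP₂ + TM₂) = (FP₁ + FP₂) / 2 := by
  have hab := phase_quarter_mul_neg_quarter
  simp only [Int.cast_neg, Int.cast_one, mul_neg_one, neg_neg] at h1 h2 h9 h10
  rw [phase_neg_pi] at h2 h10
  rw [phase_half_pi, phase_neg_half_pi] at h10
  rw [phase_neg_half_pi] at h9
  rw [h1, h2, h3, h4, h5, h6, h7, h8, h9, h10, cos_pi_div_twelve_eq, sqrt_three_eq, exp_I_pi_div_four, exp_neg_I_pi_div_four,
    gTilt_one, gTilt_neg_one]
  refine ⟨?_, ?_, ?_⟩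
  · linear_combination (Φ * (phase (-(Real.pi / 4)) * phase (-(Real.pi / 4)) * phase (-(Real.pi / 4)))) * hab
  · ring
  · ring


end Summit.CriticalPhenomena.CardyFormulaZ2.Cruxes.ParafermionToSLESixFamilies.FlipInvolutionReturnLaw

end
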